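import Mathlib
import HarnessLib
import Literature.MathematicalPhysics.QuantumLattice.SectorisedKernelNormRefinementPlateau
import Summits.HubbardSuperconductivity.HubbardSuperconductivity.Theorems.KLProgrammeKLRegimeEngineNormsStepDoor
import Summits.HubbardSuperconductivity.HubbardSuperconductivity.Theorems.KLProgrammeH10TwoPointLimitSectorMultiplierFat

/-!
# Route `KLProgramme` — crux K3 ENGINE, item stmt-HubbardSuperconductivity-20437 `KLRegimeEngineV17F2`, stub (b) `stub_engine_step_norms`
# (clause (E1), blocked birth-level tower): RE-SECTORISATION AT A JUMP `k → J′` (`J′ ≥ k+1`) WITH THE RELATIVE SECTOR COUNT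

Cell gate-hubbard-kl, seat hubbard-kl-k3c2-p3 (g5); E1-CORE-TARGET CT-2(ii) / E1-TOWER-AUDIT §3 / r2d-p2 g5 (A1) «BLOCKED»: an increment born at
the block boundary `J_{k′}` is bounded ONCE in the thin family of its birth level and re-measured at a later boundary `J′` in the thin family of
index `J′`; the price is one overlap `L¹` norm per leg and the NUMBER OF ADMISSIBLE FINE TUPLES REFINING A COARSE ONE through the anchored leg
(Benfatto–Giuliani–Mastropietro 2006 (2.82)–(2.83) with the relative sector counting lemma (2.89)/(A3.1)) — not the flat child count
`(27·2^{J′−k})^m` of the consecutive-step export `EngineV8.klAnisoLegKernelNorm_le_of_lag`.  This file is the KL-vocabulary instance of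
`Literature.…SectorisedKernelNormRefinementPlateau.hubbardSectorKernelNorm_refine_le_of_plateau_pair` for the plateau pair
`(klAnisoFamily k, bgmFatMultiplier k ; klAnisoFamily J′)`, `k + 1 ≤ J′` (the thin family of index `J′` lives in the plateau of the thin family
of index `k`: `sum_klAnisoFamily_eq_one_of_klAnisoFamily_ne_zero`), with the child relation := SUPPORT OVERLAP of `klAnisoFamily J′ ω″` and
`bgmFatMultiplier k ω′`:

* **`hubbardSectorKernelNorm_klAniso_jump_le_of_relCount`** — for every `G`, degree `m + 1` and constraint set `A″` of `klAnisoFamily J′`-labels: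
  `‖G‖_{klAnisoFamily J′, A″} ≤ cr · c₁^m · R · ε^m · (ε · ‖G‖_{klAnisoFamily k, univ})`, where `cr` bounds the row sums of
  `‖E(klAnisoFamily J′)·S(F̃_k)‖`, `c₁` the per-sector-pair position sums (fine position summed, labels matched), and `R` the number of
  `σ″ ∈ A″` through a pinned leg whose legs overlap, leg by leg (same spin/charge), the fat sectors of a given coarse label tuple.

* `hubbardSectorKernelNorm_klAniso_jump_le_of_relCount_split` — the CORRELATED-count version: with a class `B` of coarse label tuples
  (e.g. the umklapp-corner class of p4's COUNTING-NOTE-2) and counts `R₁` off `B`, `R₂` on `B`: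
  `‖G‖_{klAnisoFamily J′, A″} ≤ cr · c₁^m · ε^m · (R₁ · (ε‖G‖_{klAnisoFamily k, univ}) + R₂ · (ε‖G‖_{klAnisoFamily k, B}))`.

* `hubbardSectorPinnedSum_klAniso_jump_le` — the PER-TUPLE companion: for one fine label tuple `σ″` of `klAnisoFamily J′`,
  `ε^m Σ_{x″_p = x} ‖W_{J′,σ″}(x″)‖ ≤ c₁^m · c₁r · P · ε^m · (ε · B)` from per-pair column/row position sums, the number `P` of coarse
  (`klAnisoFamily k`) label tuples that `σ″` overlaps leg by leg, and a bound `B` on the single-tuple pinned sizes at level `k` — the second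
  component of the (anchored sum, per-tuple size) bookkeeping the correlated count needs.

* `card_parents_klAniso_le` — the parents count is discharged: a fine label tuple of `klAnisoFamily J′` overlaps leg by leg (same spin and
  charge) at most `27^{m+1}` label tuples of `bgmFatMultiplier k`, `k ≤ J′` (p4's `card_overlap_klAniso_bgmFat_coarse_le`, leg by leg).

The three inputs are counting-lane rows: `cr`, `c₁` = p4's overlap-kernel sums (`TorusFourierL2.overlapKernel_sums_le_of_charSum_le` gives exactly the
per-pair form of `c₁`; `…SectorMultiplierOverlapRegime` the consecutive-step constants), `R` = the relative count (row (V)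
`relCount_lastLeg_frame_le` today, exponent `L−2`; BGM06 Lemma A3.1, exponent `L−3`, when typed).  Everything is proved; no definitions; nothing
about the model is asserted beyond this implication.
-/

noncomputable section

namespace Summit.HubbardSuperconductivity.HubbardSuperconductivity.Theorems.EngineV8

set_option linter.dupNamespace false -- summit = problem name (single-conjunct summit), D-0017

open Classical
open Real Finset Literature.MathematicalPhysics.QuantumLattice Literature.Probability.LatticeModels GrassmannAlgebra
open Summit.HubbardSuperconductivity.HubbardSuperconductivity.Theorems.KLProgrammeLegKernels
open Summit.HubbardSuperconductivity.HubbardSuperconductivity.Theorems.KLRegimeSplit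
open Summit.HubbardSuperconductivity.HubbardSuperconductivity.Theorems.TorusFourierL2

variable {L M : ℕ} [NeZero L] [NeZero M]

/-- **Re-sectorisation at a jump with the relative sector count** (BGM 2006 (2.82)–(2.83), (2.89)): for `k + 1 ≤ J′`, every Grassmann
polynomial `G` of the Hubbard torus, degree `m + 1` and constraint set `A″`, with `cr` bounding the row sums and `c₁` the per-sector-pair fine-position
sums of `‖E(klAnisoFamily … J′)·S(bgmFatMultiplier … k)‖`, and `R` the number of `σ″ ∈ A″` through any pinned leg `σ″_p = ℓ″` whose legs overlap leg by
leg (support overlap of the sector index, same spin and charge) a given coarse label tuple `σ′`: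
`‖G‖_{klAnisoFamily J′, A″} ≤ cr · c₁^m · R · ε_x^m · (ε_x · ‖G‖_{klAnisoFamily k, univ})`. -/
theorem hubbardSectorKernelNorm_klAniso_jump_le_of_relCount {β : ℝ} (hβ : 0 < β) (μ : ℝ) (K : TrigPolyC4v) {k J' : ℕ} (hJ : k + 1 ≤ J')
    (G : HubbardGrassmann L M) {cr c₁ R : ℝ} (hcr0 : 0 ≤ cr) (hc₁0 : 0 ≤ c₁) (hR0 : 0 ≤ R)
    (hrow' : ∀ X'', ∑ X', ‖(sectorAnalysisMatrix L M β (klAnisoFamily L M β μ K klE0 J') *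
      sectorSubMatrix L M β (bgmFatMultiplier L M klE0 β (nambuXiCT L μ K) k)) X'' X'‖ ≤ cr)
    (hcol₁ : ∀ (ω'' : Fin (sectorCount J')) (ω' : Fin (sectorCount k)) (σ c : Fin 2) (x' : SpaceTimeIdx L M),
      ∑ x'' : SpaceTimeIdx L M, ‖(sectorAnalysisMatrix L M β (klAnisoFamily L M β μ K klE0 J') *
        sectorSubMatrix L M β (bgmFatMultiplier L M klE0 β (nambuXiCT L μ K) k)) (x'', ((ω'', σ), c)) (x', ((ω', σ), c))‖ ≤ c₁)
    (m : ℕ) (A'' : Finset (Fin (m + 1) → SectorLeg (sectorCount J')))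
    (hR : ∀ (σ' : Fin (m + 1) → SectorLeg (sectorCount k)) (p : Fin (m + 1)) (ℓ'' : SectorLeg (sectorCount J')),
      (((A''.filter fun σ'' => σ'' p = ℓ'' ∧ ∀ i,
          (∃ q : FreqMomentum L M, klAnisoFamily L M β μ K klE0 J' (σ'' i).1.1 q ≠ 0 ∧
            bgmFatMultiplier L M klE0 β (nambuXiCT L μ K) k (σ' i).1.1 q ≠ 0) ∧
          (σ' i).1.2 = (σ'' i).1.2 ∧ (σ' i).2 = (σ'' i).2).card : ℝ)) ≤ R) :
    hubbardSectorKernelNorm L M β (klAnisoFamily L M β μ K klE0 J') A'' G ≤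
      cr * c₁ ^ m * R * imagTimeWeight β M ^ m *
        (imagTimeWeight β M * hubbardSectorKernelNorm L M β (klAnisoFamily L M β μ K klE0 k)
          (univ : Finset (Fin (m + 1) → SectorLeg (sectorCount k))) G) := by
  have he : (0 : ℝ) < klE0 := by norm_num [klE0]
  set F' := klAnisoFamily L M β μ K klE0 J' with hF'
  set F := klAnisoFamily L M β μ K klE0 k with hF
  set Ft := bgmFatMultiplier L M klE0 β (nambuXiCT L μ K) k with hFt
  -- the per-pair position sums for arbitrary label pairs: mismatched spin/charge entries vanish
  have hcol₁' : ∀ (ℓ'' : SectorLeg (sectorCount J')) (X' : SpaceTimeIdx L M × SectorLeg (sectorCount k)),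
      ∑ x'' : SpaceTimeIdx L M, ‖(sectorAnalysisMatrix L M β F' * sectorSubMatrix L M β Ft) (x'', ℓ'') X'‖ ≤ c₁ := by
    rintro ⟨⟨ω'', σ''⟩, c''⟩ ⟨x', ⟨ω', σ'⟩, c'⟩
    by_cases hlab : σ' = σ'' ∧ c' = c''
    · obtain ⟨rfl, rfl⟩ := hlab
      exact hcol₁ ω'' ω' σ' c' x'
    · refine le_of_eq_of_le (sum_eq_zero fun x'' _ => ?_) hc₁0
      rw [sectorAnalysis_mul_sectorSub_apply, if_neg (by exact hlab), norm_zero]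
  -- the Literature layer with child := support overlap
  have h := hubbardSectorKernelNorm_refine_le_of_plateau_pair hβ F Ft
    (fun ω p => bgmFatMultiplier_mul_bgmMultiplier he β (nambuXiCT L μ K) k ω p)
    (fun p hp ω => klAnisoFamily_eq_zero_of_sum_eq_zero β μ K klE0 k p hp ω) F'
    (fun ω' p hne => sum_klAnisoFamily_eq_one_of_klAnisoFamily_ne_zero β μ K hJ ω' p hne) G
    (fun ω'' ω' => ∃ q : FreqMomentum L M, F' ω'' q ≠ 0 ∧ Ft ω' q ≠ 0)
    (fun ω'' ω' hno q => by
      by_contra hq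
      exact hno ⟨q, (mul_ne_zero_iff.1 hq).1, (mul_ne_zero_iff.1 hq).2⟩)
    hcr0 hc₁0 hR0 hrow' hcol₁' m A'' (fun σ' p ℓ'' => by convert hR σ' p ℓ'' using 4)
  exact h


/-- **Re-sectorisation at a jump with a CORRELATED relative sector count** (BGM 2006 (2.82)–(2.83), (2.89); cell gate-hubbard-kl, p4 COUNTING-NOTE-2
§5(c1): on the lattice the relative count is larger on the umklapp-corner class of coarse tuples, and the class must be carried into the parent's
sum): data as in `hubbardSectorKernelNorm_klAniso_jump_le_of_relCount`, plus a class `B` of coarse label tuples with the count `≤ R₁` off `B` and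
`≤ R₂` on `B`. Then `‖G‖_{klAnisoFamily J′, A″} ≤ cr · c₁^m · ε_x^m · (R₁ · (ε_x‖G‖_{klAnisoFamily k, univ}) + R₂ · (ε_x‖G‖_{klAnisoFamily k, B}))`. -/
theorem hubbardSectorKernelNorm_klAniso_jump_le_of_relCount_split {β : ℝ} (hβ : 0 < β) (μ : ℝ) (K : TrigPolyC4v) {k J' : ℕ}
    (hJ : k + 1 ≤ J') (G : HubbardGrassmann L M) {cr c₁ R₁ R₂ : ℝ} (hcr0 : 0 ≤ cr) (hc₁0 : 0 ≤ c₁) (hR₁ : 0 ≤ R₁) (hR₂ : 0 ≤ R₂)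
    (hrow' : ∀ X'', ∑ X', ‖(sectorAnalysisMatrix L M β (klAnisoFamily L M β μ K klE0 J') *
      sectorSubMatrix L M β (bgmFatMultiplier L M klE0 β (nambuXiCT L μ K) k)) X'' X'‖ ≤ cr)
    (hcol₁ : ∀ (ω'' : Fin (sectorCount J')) (ω' : Fin (sectorCount k)) (σ c : Fin 2) (x' : SpaceTimeIdx L M),
      ∑ x'' : SpaceTimeIdx L M, ‖(sectorAnalysisMatrix L M β (klAnisoFamily L M β μ K klE0 J') *
        sectorSubMatrix L M β (bgmFatMultiplier L M klE0 β (nambuXiCT L μ K) k)) (x'', ((ω'', σ), c)) (x', ((ω', σ), c))‖ ≤ c₁)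
    (m : ℕ) (A'' : Finset (Fin (m + 1) → SectorLeg (sectorCount J'))) (B : Finset (Fin (m + 1) → SectorLeg (sectorCount k)))
    (hRoff : ∀ (σ' : Fin (m + 1) → SectorLeg (sectorCount k)), σ' ∉ B → ∀ (p : Fin (m + 1)) (ℓ'' : SectorLeg (sectorCount J')),
      (((A''.filter fun σ'' => σ'' p = ℓ'' ∧ ∀ i,
          (∃ q : FreqMomentum L M, klAnisoFamily L M β μ K klE0 J' (σ'' i).1.1 q ≠ 0 ∧
            bgmFatMultiplier L M klE0 β (nambuXiCT L μ K) k (σ' i).1.1 q ≠ 0) ∧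
          (σ' i).1.2 = (σ'' i).1.2 ∧ (σ' i).2 = (σ'' i).2).card : ℝ)) ≤ R₁)
    (hRon : ∀ (σ' : Fin (m + 1) → SectorLeg (sectorCount k)), σ' ∈ B → ∀ (p : Fin (m + 1)) (ℓ'' : SectorLeg (sectorCount J')),
      (((A''.filter fun σ'' => σ'' p = ℓ'' ∧ ∀ i,
          (∃ q : FreqMomentum L M, klAnisoFamily L M β μ K klE0 J' (σ'' i).1.1 q ≠ 0 ∧
            bgmFatMultiplier L M klE0 β (nambuXiCT L μ K) k (σ' i).1.1 q ≠ 0) ∧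
          (σ' i).1.2 = (σ'' i).1.2 ∧ (σ' i).2 = (σ'' i).2).card : ℝ)) ≤ R₂) :
    hubbardSectorKernelNorm L M β (klAnisoFamily L M β μ K klE0 J') A'' G ≤
      cr * c₁ ^ m * imagTimeWeight β M ^ m *
        (R₁ * (imagTimeWeight β M * hubbardSectorKernelNorm L M β (klAnisoFamily L M β μ K klE0 k)
            (univ : Finset (Fin (m + 1) → SectorLeg (sectorCount k))) G) +
          R₂ * (imagTimeWeight β M * hubbardSectorKernelNorm L M β (klAnisoFamily L M β μ K klE0 k) B G)) := by
  have he : (0 : ℝ) < klE0 := by norm_num [klE0]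
  set F' := klAnisoFamily L M β μ K klE0 J' with hF'
  set F := klAnisoFamily L M β μ K klE0 k with hF
  set Ft := bgmFatMultiplier L M klE0 β (nambuXiCT L μ K) k with hFt
  -- the per-pair position sums for arbitrary label pairs: mismatched spin/charge entries vanish
  have hcol₁' : ∀ (ℓ'' : SectorLeg (sectorCount J')) (X' : SpaceTimeIdx L M × SectorLeg (sectorCount k)),
      ∑ x'' : SpaceTimeIdx L M, ‖(sectorAnalysisMatrix L M β F' * sectorSubMatrix L M β Ft) (x'', ℓ'') X'‖ ≤ c₁ := by
    rintro ⟨⟨ω'', σ''⟩, c''⟩ ⟨x', ⟨ω', σ'⟩, c'⟩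
    by_cases hlab : σ' = σ'' ∧ c' = c''
    · obtain ⟨rfl, rfl⟩ := hlab
      exact hcol₁ ω'' ω' σ' c' x'
    · refine le_of_eq_of_le (sum_eq_zero fun x'' _ => ?_) hc₁0
      rw [sectorAnalysis_mul_sectorSub_apply, if_neg (by exact hlab), norm_zero]
  have h := hubbardSectorKernelNorm_refine_le_split_of_plateau_pair hβ F Ft
    (fun ω p => bgmFatMultiplier_mul_bgmMultiplier he β (nambuXiCT L μ K) k ω p)
    (fun p hp ω => klAnisoFamily_eq_zero_of_sum_eq_zero β μ K klE0 k p hp ω) F'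
    (fun ω' p hne => sum_klAnisoFamily_eq_one_of_klAnisoFamily_ne_zero β μ K hJ ω' p hne) G
    (fun ω'' ω' => ∃ q : FreqMomentum L M, F' ω'' q ≠ 0 ∧ Ft ω' q ≠ 0)
    (fun ω'' ω' hno q => by
      by_contra hq
      exact hno ⟨q, (mul_ne_zero_iff.1 hq).1, (mul_ne_zero_iff.1 hq).2⟩)
    hcr0 hc₁0 hR₁ hR₂ hrow' hcol₁' m A'' B
    (fun σ' hσ' p ℓ'' => by convert hRoff σ' hσ' p ℓ'' using 4) (fun σ' hσ' p ℓ'' => by convert hRon σ' hσ' p ℓ'' using 4)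
  exact h


/-- **Per-tuple pinned sizes at a jump** (BGM 2006 (2.82), one overlap `L¹` norm per leg, no sector sum): for `k + 1 ≤ J′`, one fine label tuple
`σ″` of `klAnisoFamily … J′`, leg `p`, position `x`: `ε^m Σ_{x″_p = x} ‖W_{J′,σ″}(x″)‖ ≤ c₁^m · c₁r · P · ε^m · (ε · B)`, given per-pair column sums
`≤ c₁` and row sums `≤ c₁r` of `‖E(klAnisoFamily J′)·S(F̃_k)‖` (labels matched), at most `P` coarse label tuples overlapping `σ″` leg by leg, and
single-tuple pinned sizes `≤ B` of `G` in `klAnisoFamily … k`. -/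
theorem hubbardSectorPinnedSum_klAniso_jump_le {β : ℝ} (hβ : 0 < β) (μ : ℝ) (K : TrigPolyC4v) {k J' : ℕ} (hJ : k + 1 ≤ J')
    (G : HubbardGrassmann L M) {c₁ c₁r Pc B : ℝ} (hc₁0 : 0 ≤ c₁) (hc₁r0 : 0 ≤ c₁r) (hB0 : 0 ≤ B)
    (hcol₁ : ∀ (ω'' : Fin (sectorCount J')) (ω' : Fin (sectorCount k)) (σ c : Fin 2) (x' : SpaceTimeIdx L M),
      ∑ x'' : SpaceTimeIdx L M, ‖(sectorAnalysisMatrix L M β (klAnisoFamily L M β μ K klE0 J') *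
        sectorSubMatrix L M β (bgmFatMultiplier L M klE0 β (nambuXiCT L μ K) k)) (x'', ((ω'', σ), c)) (x', ((ω', σ), c))‖ ≤ c₁)
    (hrow₁ : ∀ (ω'' : Fin (sectorCount J')) (ω' : Fin (sectorCount k)) (σ c : Fin 2) (x'' : SpaceTimeIdx L M),
      ∑ x' : SpaceTimeIdx L M, ‖(sectorAnalysisMatrix L M β (klAnisoFamily L M β μ K klE0 J') *
        sectorSubMatrix L M β (bgmFatMultiplier L M klE0 β (nambuXiCT L μ K) k)) (x'', ((ω'', σ), c)) (x', ((ω', σ), c))‖ ≤ c₁r)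
    (m : ℕ)
    (hPc : ∀ σ'' : Fin (m + 1) → SectorLeg (sectorCount J'),
      (((univ.filter fun σ' : Fin (m + 1) → SectorLeg (sectorCount k) => ∀ i,
          (∃ q : FreqMomentum L M, klAnisoFamily L M β μ K klE0 J' (σ'' i).1.1 q ≠ 0 ∧
            bgmFatMultiplier L M klE0 β (nambuXiCT L μ K) k (σ' i).1.1 q ≠ 0) ∧
          (σ' i).1.2 = (σ'' i).1.2 ∧ (σ' i).2 = (σ'' i).2).card : ℝ)) ≤ Pc)
    (hBF : ∀ (σ' : Fin (m + 1) → SectorLeg (sectorCount k)) (p : Fin (m + 1)) (y : SpaceTimeIdx L M),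
      imagTimeWeight β M ^ m * ∑ x' ∈ univ.filter (fun x' : Fin (m + 1) → SpaceTimeIdx L M => x' p = y),
        ‖sectorisedKernel L M β (klAnisoFamily L M β μ K klE0 k) G (m + 1) σ' x'‖ ≤ B)
    (σ'' : Fin (m + 1) → SectorLeg (sectorCount J')) (p : Fin (m + 1)) (x : SpaceTimeIdx L M) :
    imagTimeWeight β M ^ m * ∑ x'' ∈ univ.filter (fun x'' : Fin (m + 1) → SpaceTimeIdx L M => x'' p = x),
        ‖sectorisedKernel L M β (klAnisoFamily L M β μ K klE0 J') G (m + 1) σ'' x''‖ ≤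
      c₁ ^ m * c₁r * Pc * imagTimeWeight β M ^ m * (imagTimeWeight β M * B) := by
  have he : (0 : ℝ) < klE0 := by norm_num [klE0]
  set F' := klAnisoFamily L M β μ K klE0 J' with hF'
  set F := klAnisoFamily L M β μ K klE0 k with hF
  set Ft := bgmFatMultiplier L M klE0 β (nambuXiCT L μ K) k with hFt
  -- the per-pair position sums for arbitrary label pairs: mismatched spin/charge entries vanish
  have hcol₁' : ∀ (ℓ'' : SectorLeg (sectorCount J')) (X' : SpaceTimeIdx L M × SectorLeg (sectorCount k)),
      ∑ x'' : SpaceTimeIdx L M, ‖(sectorAnalysisMatrix L M β F' * sectorSubMatrix L M β Ft) (x'', ℓ'') X'‖ ≤ c₁ := by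
    rintro ⟨⟨ω'', σ''⟩, c''⟩ ⟨x', ⟨ω', σ'⟩, c'⟩
    by_cases hlab : σ' = σ'' ∧ c' = c''
    · obtain ⟨rfl, rfl⟩ := hlab
      exact hcol₁ ω'' ω' σ' c' x'
    · refine le_of_eq_of_le (sum_eq_zero fun x'' _ => ?_) hc₁0
      rw [sectorAnalysis_mul_sectorSub_apply, if_neg (by exact hlab), norm_zero]
  have hrow₁' : ∀ (X'' : SpaceTimeIdx L M × SectorLeg (sectorCount J')) (ℓ' : SectorLeg (sectorCount k)),
      ∑ x' : SpaceTimeIdx L M, ‖(sectorAnalysisMatrix L M β F' * sectorSubMatrix L M β Ft) X'' (x', ℓ')‖ ≤ c₁r := by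
    rintro ⟨x'', ⟨ω'', σ''⟩, c''⟩ ⟨⟨ω', σ'⟩, c'⟩
    by_cases hlab : σ' = σ'' ∧ c' = c''
    · obtain ⟨rfl, rfl⟩ := hlab
      exact hrow₁ ω'' ω' σ' c' x''
    · refine le_of_eq_of_le (sum_eq_zero fun x' _ => ?_) hc₁r0
      rw [sectorAnalysis_mul_sectorSub_apply, if_neg (by exact hlab), norm_zero]
  have h := hubbardSectorPinnedSum_refine_le_of_plateau_pair hβ F Ft
    (fun ω p => bgmFatMultiplier_mul_bgmMultiplier he β (nambuXiCT L μ K) k ω p)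
    (fun p hp ω => klAnisoFamily_eq_zero_of_sum_eq_zero β μ K klE0 k p hp ω) F'
    (fun ω' p hne => sum_klAnisoFamily_eq_one_of_klAnisoFamily_ne_zero β μ K hJ ω' p hne) G
    (fun ω'' ω' => ∃ q : FreqMomentum L M, F' ω'' q ≠ 0 ∧ Ft ω' q ≠ 0)
    (fun ω'' ω' hno q => by
      by_contra hq
      exact hno ⟨q, (mul_ne_zero_iff.1 hq).1, (mul_ne_zero_iff.1 hq).2⟩)
    hc₁0 hc₁r0 hB0 hcol₁' hrow₁' m (fun σ''₀ => by convert hPc σ''₀ using 4) hBF σ'' p x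
  exact h


omit [NeZero M] in
/-- **The parents count, discharged**: a label tuple `σ″` of the thin family of index `J′` overlaps leg by leg (support overlap of the sector
index with the FAT multiplier of index `k ≤ J′`, same spin and charge) at most `27^{m+1}` label tuples of index `k` — p4's
`card_overlap_klAniso_bgmFat_coarse_le` (≤ 27 per leg) multiplied over the legs. -/
theorem card_parents_klAniso_le (β μ : ℝ) (K : TrigPolyC4v) {k J' : ℕ} (hkJ : k ≤ J') (m : ℕ)
    (σ'' : Fin (m + 1) → SectorLeg (sectorCount J')) :
    (((univ.filter fun σ' : Fin (m + 1) → SectorLeg (sectorCount k) => ∀ i,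
        (∃ q : FreqMomentum L M, klAnisoFamily L M β μ K klE0 J' (σ'' i).1.1 q ≠ 0 ∧
          bgmFatMultiplier L M klE0 β (nambuXiCT L μ K) k (σ' i).1.1 q ≠ 0) ∧
        (σ' i).1.2 = (σ'' i).1.2 ∧ (σ' i).2 = (σ'' i).2).card : ℝ)) ≤ 27 ^ (m + 1) := by
  have he : (0 : ℝ) < klE0 := by norm_num [klE0]
  -- leg by leg: the admissible coarse labels of leg `i`
  set t : Fin (m + 1) → Finset (SectorLeg (sectorCount k)) := fun i => univ.filter fun ℓ' : SectorLeg (sectorCount k) =>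
      (∃ q : FreqMomentum L M, klAnisoFamily L M β μ K klE0 J' (σ'' i).1.1 q ≠ 0 ∧
        bgmFatMultiplier L M klE0 β (nambuXiCT L μ K) k ℓ'.1.1 q ≠ 0) ∧
      ℓ'.1.2 = (σ'' i).1.2 ∧ ℓ'.2 = (σ'' i).2 with ht
  have hsub : (univ.filter fun σ' : Fin (m + 1) → SectorLeg (sectorCount k) => ∀ i,
        (∃ q : FreqMomentum L M, klAnisoFamily L M β μ K klE0 J' (σ'' i).1.1 q ≠ 0 ∧
          bgmFatMultiplier L M klE0 β (nambuXiCT L μ K) k (σ' i).1.1 q ≠ 0) ∧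
        (σ' i).1.2 = (σ'' i).1.2 ∧ (σ' i).2 = (σ'' i).2) ⊆ Fintype.piFinset t := by
    intro σ' hσ'
    rw [Fintype.mem_piFinset]
    intro i
    simp only [ht, mem_filter, mem_univ, true_and]
    exact (mem_filter.1 hσ').2 i
  have hti : ∀ i, (t i).card ≤ 27 := by
    intro i
    calc (t i).card ≤ ((univ : Finset (Fin (sectorCount k))).filter (fun ω₂ : Fin (sectorCount k) =>
          ∃ q : FreqMomentum L M, klAnisoFamily L M β μ K klE0 J' (σ'' i).1.1 q ≠ 0 ∧
            bgmFatMultiplier L M klE0 β (nambuXiCT L μ K) k ω₂ q ≠ 0)).card := by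
          refine Finset.card_le_card_of_injOn (fun ℓ' : SectorLeg (sectorCount k) => ℓ'.1.1) (fun ℓ' hℓ' => ?_)
            (fun ℓ₁ h₁ ℓ₂ h₂ heq => ?_)
          · simp only [ht, mem_coe, mem_filter, mem_univ, true_and] at hℓ' ⊢
            exact hℓ'.1
          · simp only [ht, mem_coe, mem_filter, mem_univ, true_and] at h₁ h₂
            exact Prod.ext (Prod.ext heq (h₁.2.1.trans h₂.2.1.symm)) (h₁.2.2.trans h₂.2.2.symm)
      _ ≤ 27 := card_overlap_klAniso_bgmFat_coarse_le he β μ K hkJ _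
  calc (((univ.filter fun σ' : Fin (m + 1) → SectorLeg (sectorCount k) => ∀ i,
        (∃ q : FreqMomentum L M, klAnisoFamily L M β μ K klE0 J' (σ'' i).1.1 q ≠ 0 ∧
          bgmFatMultiplier L M klE0 β (nambuXiCT L μ K) k (σ' i).1.1 q ≠ 0) ∧
        (σ' i).1.2 = (σ'' i).1.2 ∧ (σ' i).2 = (σ'' i).2).card : ℝ))
      ≤ (Fintype.piFinset t).card := by exact_mod_cast card_le_card hsub
    _ = ∏ i, ((t i).card : ℝ) := by rw [Fintype.card_piFinset]; push_cast; rfl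
    _ ≤ ∏ _i : Fin (m + 1), (27 : ℝ) := prod_le_prod (fun i _ => by positivity) (fun i _ => by exact_mod_cast hti i)
    _ = 27 ^ (m + 1) := by rw [prod_const, card_univ, Fintype.card_fin]

end Summit.HubbardSuperconductivity.HubbardSuperconductivity.Theorems.EngineV8

end
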